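import Summits.RiemannHypothesis.RiemannHypothesis.Theorems.LiTailLaguerreDefs
import Summits.RiemannHypothesis.RiemannHypothesis.Theorems.LiPrimeEchoWindowContour
import Summits.RiemannHypothesis.RiemannHypothesis.Theorems.LiPrimeEchoNonresonant
import HarnessLib

/-!
# RiemannHypothesis / LiTailLaguerre — crux K1′ `LiTailContour`, part 2: the finite half-strip identity (RH-FREE)

RH-FREE [rh-li-eng g5; binder K1′].  Bombieri's rectangle `[−1/2, 3/2] × [T, Y]` for `ξ'/ξ` against the weight `1 − F_n`
(`F_n(s) = (1 − 1/s)ⁿ`), at good heights `1 ≤ T < Y`: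

  `Re Σ_{box Y} m(1 − z_ρⁿ) − Re Σ_{box T} m(1 − z_ρⁿ) = (1/π) Re ∫_T^Y ξ'/ξ(3/2 + iy)·(2 − k_n(3/2 + iy)) dy + liHorizTail n T − liHorizTail n Y`

(`tail_window_contour`): the residues are the window's zeros at ANY real part with multiplicity, the box is symmetric under
conjugation (so the both-signs sum is twice the real part of the upper sum), and the left edge folds onto the right one by
`ξ'/ξ(1 − s) = −ξ'/ξ(s)`, `ξ'/ξ(s̄) = conj`, `F_n(s̄) = conj F_n(s)`, producing the CO-WEIGHT `2 − k_n = (1 − F_n(w)) + (1 − F_n(1 − w))`;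
then `ξ'/ξ = 1/w + 1/(w−1) − ½log π + ½ψ(w/2) − L(Λ, w)` splits the right edge (`tail_rightEdge_split`).  Same template as
the closed route LiPrimeEcho's `WindowContour.window_contour` / `rightEdge_split`.  Nothing here bears on the truth of RH.
-/

noncomputable section

-- D-0017: `Summit.<S>.<S>.…` is the designed namespace of a single-problem summit.
set_option linter.dupNamespace false

open Complex MeasureTheory intervalIntegral Set
open scoped Real Interval ComplexConjugate ArithmeticFunction.vonMangoldt

namespace Summit.RiemannHypothesis.RiemannHypothesis.Theorems.LiTheory

open Literature.NumberTheory.LFunctions Literature.NumberTheory.LFunctions.SchoenfeldBound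
open BoxSplit

namespace TailContour

open WindowContour PrimeEdge

/-! ### The zero side: both signs = twice the upper half-plane -/

/-- `Re Σ_{box T} m(1 − zⁿ) = 2 Σ_{0 < Im ρ ≤ T} m Re(1 − zⁿ)`. -/
theorem boxTail_eq_two_mul_sum (n : ℕ) (T : ℝ) :
    (∑ᶠ ρ ∈ liZeroBox T, (riemannZetaZeroOrder ρ : ℂ) * (1 - (1 - 1 / ρ) ^ n)).re =
      2 * ∑ ρ ∈ zerosBetween 0 T, (riemannZetaZeroOrder ρ : ℝ) * (1 - (1 - 1 / ρ) ^ n).re := by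
  -- as `WindowAdjust.liZeroTrace_eq_two_mul_sum` with the weight `1 − zⁿ`
  classical
  rw [finsum_mem_eq_finite_toFinset_sum _ (liZeroBox_finite T), Complex.re_sum]
  set B := (liZeroBox_finite T).toFinset with hB
  have hmem : ∀ ρ, ρ ∈ B ↔ ρ ∈ liZeroBox T := fun ρ ↦ Set.Finite.mem_toFinset _
  set f : ℂ → ℝ := fun ρ ↦ ((riemannZetaZeroOrder ρ : ℂ) * (1 - (1 - 1 / ρ) ^ n)).re with hf
  have hfval : ∀ ρ : ℂ, f ρ = (riemannZetaZeroOrder ρ : ℝ) * (1 - (1 - 1 / ρ) ^ n).re := by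
    intro ρ
    simp only [hf, Complex.mul_re, Complex.intCast_re, Complex.intCast_im, zero_mul, sub_zero]
  set S := zerosBetween 0 T with hS
  have hSsub : S ⊆ B := by
    intro ρ hρ
    obtain ⟨hz, h0, h1, h3, h4⟩ := (mem_zerosBetween le_rfl).1 hρ
    rw [hmem]
    exact ⟨hz, h0, h1, by rwa [abs_of_pos h3], by rwa [abs_of_pos h3]⟩
  have hS'sub : S.image conj ⊆ B := by
    intro ρ' hρ'
    obtain ⟨ρ, hρ, rfl⟩ := Finset.mem_image.1 hρ'
    exact (hmem _).2 (conj_mem_of_mem_zerosBetween le_rfl le_rfl hρ).1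
  have hcover : B ⊆ S ∪ S.image conj := by
    intro ρ hρ
    obtain ⟨hz, h0, h1, him, hT'⟩ := (hmem ρ).1 hρ
    have him0 : ρ.im ≠ 0 := abs_pos.1 him
    rw [Finset.mem_union]
    rcases lt_or_gt_of_ne him0 with hneg | hpos
    · right
      rw [Finset.mem_image]
      refine ⟨conj ρ, (mem_zerosBetween le_rfl).2 ⟨by rw [riemannZeta_conj, hz, map_zero], by simpa using h0,
        by simpa using h1, ?_, ?_⟩, by simp⟩
      · rw [Complex.conj_im]; linarith
      · rw [Complex.conj_im]; rw [abs_of_neg hneg] at hT'; exact hT'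
    · left
      rw [abs_of_pos hpos] at hT'
      exact (mem_zerosBetween le_rfl).2 ⟨hz, h0, h1, hpos, hT'⟩
  have hBeq : B = S ∪ S.image conj :=
    Finset.Subset.antisymm hcover (Finset.union_subset hSsub hS'sub)
  have hdisj : Disjoint S (S.image conj) := by
    rw [Finset.disjoint_left]
    intro ρ hρ hρ'
    obtain ⟨ρ₀, hρ₀, he⟩ := Finset.mem_image.1 hρ'
    obtain ⟨-, -, -, h3, -⟩ := (mem_zerosBetween le_rfl).1 hρ
    obtain ⟨-, -, -, h3', -⟩ := (mem_zerosBetween le_rfl).1 hρ₀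
    have : ρ.im = -ρ₀.im := by rw [← he, Complex.conj_im]
    linarith
  have hconj_inj : Set.InjOn (conj : ℂ → ℂ) S := fun x _ y _ h ↦ by
    simpa using congrArg conj h
  have hfconj : ∀ ρ : ℂ, f (conj ρ) = f ρ := by
    intro ρ
    rw [hfval, hfval, riemannZetaZeroOrder_conj_holds ρ]
    congr 1
    have : (1 : ℂ) - (1 - 1 / conj ρ) ^ n = conj (1 - (1 - 1 / ρ) ^ n) := by
      simp [map_sub, map_pow]
    rw [this, Complex.conj_re]
  have hSimage : ∑ ρ ∈ S.image conj, f ρ = ∑ ρ ∈ S, f ρ := by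
    rw [Finset.sum_image hconj_inj]
    exact Finset.sum_congr rfl fun ρ _ ↦ hfconj ρ
  rw [hBeq, Finset.sum_union hdisj, hSimage, ← two_mul]
  congr 1
  exact Finset.sum_congr rfl fun ρ _ ↦ hfval ρ

/-- The window difference: for `0 ≤ a ≤ b`,
`Re Σ_{box b} m(1 − zⁿ) − Re Σ_{box a} m(1 − zⁿ) = 2 Σ_{a < Im ρ ≤ b} m Re(1 − zⁿ)`. -/
theorem boxTail_sub_eq (n : ℕ) {a b : ℝ} (ha : 0 ≤ a) (hab : a ≤ b) :
    (∑ᶠ ρ ∈ liZeroBox b, (riemannZetaZeroOrder ρ : ℂ) * (1 - (1 - 1 / ρ) ^ n)).re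
      - (∑ᶠ ρ ∈ liZeroBox a, (riemannZetaZeroOrder ρ : ℂ) * (1 - (1 - 1 / ρ) ^ n)).re =
      2 * ∑ ρ ∈ zerosBetween a b, (riemannZetaZeroOrder ρ : ℝ) * (1 - (1 - 1 / ρ) ^ n).re := by
  classical
  rw [boxTail_eq_two_mul_sum, boxTail_eq_two_mul_sum, ← mul_sub]
  congr 1
  have hsub : zerosBetween 0 a ⊆ zerosBetween 0 b := by
    intro ρ hρ
    rw [mem_zerosBetween le_rfl] at hρ ⊢
    exact ⟨hρ.1, hρ.2.1, hρ.2.2.1, hρ.2.2.2.1, hρ.2.2.2.2.trans hab⟩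
  have hsd : zerosBetween a b = zerosBetween 0 b \ zerosBetween 0 a := by
    ext ρ
    rw [Finset.mem_sdiff, mem_zerosBetween ha, mem_zerosBetween le_rfl, mem_zerosBetween le_rfl]
    constructor
    · rintro ⟨h0', h1', h2', h3', h4'⟩
      exact ⟨⟨h0', h1', h2', by linarith, h4'⟩, fun h' ↦ by linarith [h'.2.2.2.2]⟩
    · rintro ⟨⟨h0', h1', h2', h3', h4'⟩, hn'⟩
      refine ⟨h0', h1', h2', ?_, h4'⟩
      by_contra hle
      exact hn' ⟨h0', h1', h2', h3', not_lt.1 hle⟩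
  rw [hsd, Finset.sum_sdiff_eq_sub hsub]

/-! ### Bombieri's rectangle with the weight `1 − F_n`, left edge folded -/

/-- The residue sum with the weight `1 − F_n`. -/
theorem residueSum_eq (n : ℕ) {T₁ T₂ : ℝ} (hT₁ : 0 < T₁) (hgood : T₂ ∈ liGoodHeights) :
    (∑ᶠ ρ ∈ {ρ : ℂ | riemannXi ρ = 0 ∧ ρ ∈ Ioo (-(1 / 2) : ℝ) (3 / 2) ×ℂ Ioo T₁ T₂},
        ((meromorphicOrderAt riemannXi ρ).untop₀ : ℂ) * (1 - liWeight n ρ)) =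
      ∑ ρ ∈ zerosBetween T₁ T₂, (riemannZetaZeroOrder ρ : ℂ) * (1 - (1 - 1 / ρ) ^ n) := by
  rw [zeroSet_eq hT₁ hgood, finsum_mem_coe_finset]
  refine Finset.sum_congr rfl fun ρ hρ ↦ ?_
  obtain ⟨hζ, -, -, hi1, -⟩ := (mem_zerosBetween hT₁.le).1 hρ
  have him : ρ.im ≠ 0 := by intro h; rw [h] at hi1; linarith
  have hmem := ZetaZeros.riemannZetaNontrivialZeros.mem_of_im_ne_zero hζ him
  rw [untop₀_meromorphicOrderAt_riemannXi (ZetaZeros.riemannZetaNontrivialZeros.re_pos hmem)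
    (ZetaZeros.riemannZetaNontrivialZeros.ne_one hmem)]
  rfl

/-- **The finite half-strip identity** (weight `1 − F_n`, left edge folded).  At good heights `1 ≤ T < Y`:
`Re Σ_{box Y} m(1 − zⁿ) − Re Σ_{box T} m(1 − zⁿ) = (1/π) Re ∫_T^Y ξ'/ξ(w)(2 − k_n(w)) dy + liHorizTail n T − liHorizTail n Y`. -/
theorem tail_window_contour (n : ℕ) {T Y : ℝ} (h1 : 1 ≤ T) (hlt : T < Y) (hgT : T ∈ liGoodHeights)
    (hgY : Y ∈ liGoodHeights) :
    (∑ᶠ ρ ∈ liZeroBox Y, (riemannZetaZeroOrder ρ : ℂ) * (1 - (1 - 1 / ρ) ^ n)).re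
      - (∑ᶠ ρ ∈ liZeroBox T, (riemannZetaZeroOrder ρ : ℂ) * (1 - (1 - 1 / ρ) ^ n)).re =
      1 / Real.pi * (∫ y in T..Y, logDeriv riemannXi (liRightPt y) * liCoSymWeight n (liRightPt y)).re
        + liHorizTail n T - liHorizTail n Y := by
  -- as `WindowContour.window_contour` with `g = 1 − F_n`
  have hT₁ : 0 < T := by linarith
  have hπ := Real.pi_pos
  have key := Literature.Analysis.Complex.integral_boundary_rect_logDeriv_mul (f := riemannXi)
    (g := fun s ↦ 1 - liWeight n s) (a := -(1 / 2)) (b := 3 / 2) (c := T) (d := Y) (by norm_num) hlt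
    (fun z _ ↦ differentiable_riemannXi.analyticAt z)
    (fun z hz ↦ analyticAt_const.sub (analyticAt_liWeight n (by
      intro h0
      have hz2 := (Complex.mem_reProdIm.1 hz).2
      rw [h0, Complex.zero_im] at hz2
      linarith [hz2.1])))
    (fun x hx ↦ hgT x hx) (fun x hx ↦ hgY x hx)
    (fun y _ ↦ riemannXi_ne_zero_of_re_le_zero (by simp))
    (fun y _ ↦ riemannXi_ne_zero_of_one_le_re (by simp; norm_num))
  simp only [← logDeriv_apply] at key
  rw [residueSum_eq n hT₁ hgY] at key
  set Z : ℂ := ∑ ρ ∈ zerosBetween T Y, (riemannZetaZeroOrder ρ : ℂ) * (1 - (1 - 1 / ρ) ^ n) with hZ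
  set Ibot := ∫ x : ℝ in (-(1 / 2) : ℝ)..(3 / 2), logDeriv riemannXi (x + T * I) * (1 - liWeight n (x + T * I))
    with hIbot
  set Itop := ∫ x : ℝ in (-(1 / 2) : ℝ)..(3 / 2), logDeriv riemannXi (x + Y * I) * (1 - liWeight n (x + Y * I))
    with hItop
  set IR := ∫ y : ℝ in T..Y, logDeriv riemannXi (((3 / 2 : ℝ) : ℂ) + y * I) *
    (1 - liWeight n (((3 / 2 : ℝ) : ℂ) + y * I)) with hIR
  set IR' := ∫ y : ℝ in T..Y, logDeriv riemannXi (((3 / 2 : ℝ) : ℂ) + y * I) *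
    (1 - liWeight n (1 - (((3 / 2 : ℝ) : ℂ) + y * I))) with hIR'
  set IL := ∫ y : ℝ in T..Y, logDeriv riemannXi (((-(1 / 2) : ℝ) : ℂ) + y * I) *
    (1 - liWeight n (((-(1 / 2) : ℝ) : ℂ) + y * I)) with hIL
  have hfold : IL = -conj IR' := by
    have e : ∀ y : ℝ, logDeriv riemannXi (((-(1 / 2) : ℝ) : ℂ) + y * I) *
        (1 - liWeight n (((-(1 / 2) : ℝ) : ℂ) + y * I)) =
        -conj (logDeriv riemannXi (((3 / 2 : ℝ) : ℂ) + y * I) *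
          (1 - liWeight n (1 - (((3 / 2 : ℝ) : ℂ) + y * I)))) := by
      intro y
      have h1 : (((-(1 / 2) : ℝ) : ℂ) + y * I) = 1 - conj (((3 / 2 : ℝ) : ℂ) + y * I) := by
        apply Complex.ext
        · simp only [Complex.add_re, Complex.ofReal_re, Complex.mul_re, Complex.I_re, Complex.ofReal_im,
            Complex.I_im, Complex.sub_re, Complex.one_re, Complex.conj_re]
          norm_num
        · simp only [Complex.add_im, Complex.ofReal_re, Complex.mul_im, Complex.I_re, Complex.ofReal_im,
            Complex.I_im, Complex.sub_im, Complex.one_im, Complex.conj_im]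
          norm_num
      have h2 : (((-(1 / 2) : ℝ) : ℂ) + y * I) = conj (1 - (((3 / 2 : ℝ) : ℂ) + y * I)) := by
        rw [h1, map_sub, map_one]
      conv_lhs => rw [h1]
      rw [logDeriv_riemannXi_one_sub, logDeriv_riemannXi_conj, ← h1, h2, liWeight_conj, map_mul, map_sub, map_one]
      ring
    rw [hIL, intervalIntegral.integral_congr (fun y _ ↦ e y), intervalIntegral.integral_neg,
      intervalIntegral.integral_of_le hlt.le, integral_conj, ← intervalIntegral.integral_of_le hlt.le]
  have hZre : (∑ᶠ ρ ∈ liZeroBox Y, (riemannZetaZeroOrder ρ : ℂ) * (1 - (1 - 1 / ρ) ^ n)).re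
      - (∑ᶠ ρ ∈ liZeroBox T, (riemannZetaZeroOrder ρ : ℂ) * (1 - (1 - 1 / ρ) ^ n)).re = 2 * Z.re := by
    rw [boxTail_sub_eq n hT₁.le hlt.le, hZ, Complex.re_sum]
    congr 1
    refine Finset.sum_congr rfl fun ρ _ ↦ ?_
    simp [Complex.mul_re]
  have h2Zre : 2 * Z.re = 1 / Real.pi * (Ibot.im - Itop.im + IR.re - IL.re) := by
    have hIm := congrArg Complex.im key
    simp only [Complex.sub_im, Complex.add_im, Complex.mul_im, Complex.I_re, Complex.I_im, Complex.mul_re,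
      Complex.ofReal_re, Complex.ofReal_im, Complex.re_ofNat, Complex.im_ofNat, zero_mul, one_mul, mul_zero,
      mul_one, zero_add, add_zero, sub_zero] at hIm
    field_simp
    linarith
  have hILre : IL.re = -IR'.re := by rw [hfold, Complex.neg_re, Complex.conj_re]
  have hc : Continuous fun y : ℝ ↦ logDeriv riemannXi (((3 / 2 : ℝ) : ℂ) + y * I) :=
    continuous_logDeriv_riemannXi_vertical (by norm_num)
  have hw0 : ∀ y : ℝ, (((3 / 2 : ℝ) : ℂ) + y * I) ≠ 0 := fun y h ↦ by
    have := congrArg Complex.re h; norm_num at this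
  have hw1 : ∀ y : ℝ, 1 - (((3 / 2 : ℝ) : ℂ) + y * I) ≠ 0 := fun y h ↦ by
    have := congrArg Complex.re h; norm_num at this
  have hcw : Continuous fun y : ℝ ↦ (((3 / 2 : ℝ) : ℂ) + y * I) := by fun_prop
  have hcw' : Continuous fun y : ℝ ↦ 1 - (((3 / 2 : ℝ) : ℂ) + y * I) := by fun_prop
  have hcF : Continuous fun y : ℝ ↦ 1 - liWeight n (((3 / 2 : ℝ) : ℂ) + y * I) := by
    refine continuous_const.sub (continuous_iff_continuousAt.2 fun y ↦ ?_)
    show ContinuousAt ((liWeight n) ∘ fun y : ℝ ↦ (((3 / 2 : ℝ) : ℂ) + y * I)) y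
    exact ContinuousAt.comp (analyticAt_liWeight n (hw0 y)).continuousAt hcw.continuousAt
  have hcF' : Continuous fun y : ℝ ↦ 1 - liWeight n (1 - (((3 / 2 : ℝ) : ℂ) + y * I)) := by
    refine continuous_const.sub (continuous_iff_continuousAt.2 fun y ↦ ?_)
    show ContinuousAt ((liWeight n) ∘ fun y : ℝ ↦ 1 - (((3 / 2 : ℝ) : ℂ) + y * I)) y
    exact ContinuousAt.comp (analyticAt_liWeight n (hw1 y)).continuousAt hcw'.continuousAt
  have i1 : IntervalIntegrable (fun y : ℝ ↦ logDeriv riemannXi (((3 / 2 : ℝ) : ℂ) + y * I) *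
      (1 - liWeight n (((3 / 2 : ℝ) : ℂ) + y * I))) volume T Y := (hc.mul hcF).intervalIntegrable _ _
  have i2 : IntervalIntegrable (fun y : ℝ ↦ logDeriv riemannXi (((3 / 2 : ℝ) : ℂ) + y * I) *
      (1 - liWeight n (1 - (((3 / 2 : ℝ) : ℂ) + y * I)))) volume T Y := (hc.mul hcF').intervalIntegrable _ _
  have hright : (∫ y in T..Y, logDeriv riemannXi (liRightPt y) * liCoSymWeight n (liRightPt y)) = IR + IR' := by
    rw [hIR, hIR', ← intervalIntegral.integral_add i1 i2]
    refine intervalIntegral.integral_congr fun y _ ↦ ?_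
    rw [liRightPt_eq, liCoSymWeight, liSymWeight]
    ring
  have hbot : liHorizTail n T = 1 / Real.pi * Ibot.im := rfl
  have htop : liHorizTail n Y = 1 / Real.pi * Itop.im := rfl
  rw [hZre, h2Zre, hright, hbot, htop, hILre, Complex.add_re]
  ring

/-! ### The right edge splits (co-weight) -/

/-- **Splitting the right edge** over `[T, Y]`:
`(1/π)Re∫ ξ'/ξ·(2 − k_n) = (1/π)Re∫ polar + (1/π)Re∫ gamma − (1/π)Re∫ prime`. -/
theorem tail_rightEdge_split (n : ℕ) (T Y : ℝ) :
    1 / Real.pi * (∫ y in T..Y, logDeriv riemannXi (liRightPt y) * liCoSymWeight n (liRightPt y)).re =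
      1 / Real.pi * (∫ y in T..Y, (1 / liRightPt y + 1 / (liRightPt y - 1)) * liCoSymWeight n (liRightPt y)).re
      + 1 / Real.pi * (∫ y in T..Y, (-(Real.log Real.pi : ℂ) / 2 + 1 / 2 * Complex.digamma (liRightPt y / 2)) *
          liCoSymWeight n (liRightPt y)).re
      - 1 / Real.pi * (∫ y in T..Y, LSeries (fun m ↦ (Λ m : ℂ)) (liRightPt y) * liCoSymWeight n (liRightPt y)).re := by
  -- as `WindowContour.rightEdge_split` with the co-weight
  have hw : ∀ y : ℝ, (liRightPt y).re = 3 / 2 := fun y ↦ by simp [liRightPt]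
  have hcow : Continuous fun y : ℝ ↦ liCoSymWeight n (liRightPt y) := by
    unfold liCoSymWeight; exact continuous_const.sub (continuous_symWeight n)
  have hcxi : Continuous fun y : ℝ ↦ logDeriv riemannXi (liRightPt y) := by
    have := continuous_logDeriv_riemannXi_vertical (c := 3 / 2) (by norm_num)
    refine this.congr fun y ↦ ?_
    rw [liRightPt_eq]
  have hcpol : Continuous fun y : ℝ ↦ (1 / liRightPt y + 1 / (liRightPt y - 1)) :=
    (continuous_const.div continuous_liRightPt liRightPt_ne_zero).add
      (continuous_const.div (continuous_liRightPt.sub continuous_const) liRightPt_sub_one_ne_zero)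
  have hcgam : Continuous fun y : ℝ ↦ (-(Real.log Real.pi : ℂ) / 2 + 1 / 2 * Complex.digamma (liRightPt y / 2)) := by
    refine continuous_iff_continuousAt.2 fun y ↦ ?_
    have hψ : ContinuousAt (fun y : ℝ ↦ Complex.digamma (liRightPt y / 2)) y :=
      (continuousAt_digamma_of_re_pos (by rw [Complex.div_ofNat_re, hw y]; norm_num)).comp
        (continuous_liRightPt.continuousAt.div_const 2)
    exact continuousAt_const.add (continuousAt_const.mul hψ)
  set A : ℝ → ℂ := fun y ↦ (1 / liRightPt y + 1 / (liRightPt y - 1)) * liCoSymWeight n (liRightPt y) with hA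
  set B : ℝ → ℂ := fun y ↦ (-(Real.log Real.pi : ℂ) / 2 + 1 / 2 * Complex.digamma (liRightPt y / 2)) *
    liCoSymWeight n (liRightPt y) with hB
  set X : ℝ → ℂ := fun y ↦ logDeriv riemannXi (liRightPt y) * liCoSymWeight n (liRightPt y) with hX
  set C : ℝ → ℂ := fun y ↦ LSeries (fun m ↦ (Λ m : ℂ)) (liRightPt y) * liCoSymWeight n (liRightPt y) with hC
  have iA : IntervalIntegrable A volume T Y := (hcpol.mul hcow).intervalIntegrable _ _
  have iB : IntervalIntegrable B volume T Y := (hcgam.mul hcow).intervalIntegrable _ _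
  have iX : IntervalIntegrable X volume T Y := (hcxi.mul hcow).intervalIntegrable _ _
  have hsplit : ∀ y : ℝ, X y = A y + B y - C y := by
    intro y
    simp only [hX, hA, hB, hC]
    rw [logDeriv_riemannXi_eq_of_one_lt_re (by rw [hw y]; norm_num)]
    simp only [LSeries]
    ring
  have iC : IntervalIntegrable C volume T Y := by
    have := (iA.add iB).sub iX
    refine this.congr fun y _ ↦ ?_
    show A y + B y - X y = C y
    rw [hsplit y]
    ring
  have hint : ∫ y in T..Y, X y = (∫ y in T..Y, A y) + (∫ y in T..Y, B y) - ∫ y in T..Y, C y := by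
    rw [← intervalIntegral.integral_add iA iB, ← intervalIntegral.integral_sub (iA.add iB) iC]
    exact intervalIntegral.integral_congr fun y _ ↦ hsplit y
  change 1 / Real.pi * (∫ y in T..Y, X y).re =
    1 / Real.pi * (∫ y in T..Y, A y).re + 1 / Real.pi * (∫ y in T..Y, B y).re - 1 / Real.pi * (∫ y in T..Y, C y).re
  rw [hint, Complex.sub_re, Complex.add_re]
  ring

end TailContour

end Summit.RiemannHypothesis.RiemannHypothesis.Theorems.LiTheory

end
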